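import Summits.HubbardSuperconductivity.HubbardSuperconductivity.Theses.InfiniteVolumeFirst
import Summits.HubbardSuperconductivity.HubbardSuperconductivity.Theorems.NoInfraredPileUp.Negative.PileUpForcesLimitAtom

/-!
# Crux `NoInfraredPileUp` (item `stmt-HubbardSuperconductivity-18534`, route InfiniteVolumeFirst rank 3):
# the price of a kill — `¬ NoInfraredPileUp` is a weak-coupling infinite-volume condensation theorem

`limitODLRO_of_not_noInfraredPileUp`.  Pure logic on top of the landed obstruction `pileUpForcesLimitAtom`
(`…/Negative/PileUpForcesLimitAtom.lean`): if the crux FAILS, then at some doping `δ ∈ (0,1/2)` and in EVERY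
coupling interval `(0, U₁)` there are a coupling `U` and an ADMISSIBLE family — normalised ground states of
`hubbardTorus 2 L 1 U` in the sector `(2⌊(1-δ)L²/2⌋, S^z = 0)` at every even side — whose translation-averaged
`d`-wave pair correlations converge pointwise, along strictly increasing even sides, to a limit with a STRICTLY
POSITIVE condensate atom: an infinite-volume torus-limit ground state with `d_{x²−y²}` off-diagonal long-range
order at arbitrarily weak coupling (for the route's rank-2 crux `NoNormalLimitState` this is the conclusion it
wants, for a cofinal family `U_n → 0`).  So a refutation of the crux cannot be cheaper than a proof of
weak-coupling pair condensation of exact Hubbard ground states — the reason the standing disprover reports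
"no kill reachable with present means" (cycle 1, `Cruxes/NoInfraredPileUp/Disproof.lean` §5).
Sources: T. Kennedy, E. H. Lieb, B. S. Shastry, PRL 61 (1988) 2582; G. L. Sewell, *Quantum Mechanics and its
Emergent Macrophysics* (2002) §3.3 (ODLRO of infinite-volume states); M. Girardeau, Phys. Fluids 5 (1962) 1468.
-/

-- the mandated namespace `Summit.<Summit>.<Problem>.Theorems` repeats `HubbardSuperconductivity`
-- (single-problem summit, D-0017), which the `dupNamespace` linter flags on every declaration
set_option linter.dupNamespace false

noncomputable section

namespace Summit.HubbardSuperconductivity.HubbardSuperconductivity.Theorems.NoInfraredPileUp.Negative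

open Literature.MathematicalPhysics.QuantumLattice Literature.Probability.LatticeModels Matrix Finset Filter
open Summit.HubbardSuperconductivity.HubbardSuperconductivity.Theses.InfiniteVolumeFirst
open scoped ComplexOrder Topology

/-- **THE PRICE OF A KILL.**  `¬ NoInfraredPileUp` ⇒ at some `δ ∈ (0,1/2)`, for every `U₁ > 0`, some
`U ∈ (0, U₁)` and some admissible ground-state family of the pure Hubbard model whose translation-averaged
`d`-wave pair correlations converge, along strictly increasing even sides, to a limit with a strictly positive
condensate atom (infinite-volume `d_{x²−y²}` ODLRO).  Contraposition bookkeeping over `pileUpForcesLimitAtom`.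
Kennedy–Lieb–Shastry, PRL 61 (1988) 2582; Sewell (2002) §3.3. [folklore] -/
theorem limitODLRO_of_not_noInfraredPileUp (h : ¬ NoInfraredPileUp) :
    ∃ δ ∈ Set.Ioo (0:ℝ) (1 / 2), ∀ U₁ : ℝ, 0 < U₁ → ∃ U ∈ Set.Ioo (0:ℝ) U₁,
      ∃ (N : ℕ → ℕ) (ψ : ∀ L, Fock (Orb (FermionTorus 2 L))),
        (∀ L, Even L → N L = 2 * ⌊(1 - δ) * (L : ℝ) ^ 2 / 2⌋₊ ∧ star (ψ L) ⬝ᵥ ψ L = 1 ∧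
            IsGroundStateInSector (hubbardTorus 2 L 1 U) (N L) 0 (ψ L)) ∧
        ∃ (Ls : ℕ → ℕ) (C : Site 2 → ℝ), StrictMono Ls ∧ (∀ j, Even (Ls j)) ∧
          (∀ x : Site 2, Tendsto (fun j : ℕ => (∑ y ∈ halfOpenBox 2 (Ls j),
              torusPullback (pairFieldCorr dWaveFormFactor ψ) (Ls j) (x + y) y) / ((Ls j : ℕ) : ℝ) ^ 2)
            atTop (𝓝 (C x))) ∧
          0 < liminf (fun R : ℕ => (∑ x ∈ halfOpenBox 2 R, ∑ y ∈ halfOpenBox 2 R, C (x - y)) /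
            ((R : ℕ) : ℝ) ^ 4) atTop := by
  by_contra hcon
  apply h
  intro δ hδ
  by_contra h1
  apply hcon
  refine ⟨δ, hδ, fun U₁ hU₁ => ?_⟩
  by_contra h2
  apply h1
  refine ⟨U₁, hU₁, fun U hU N ψ hadm => ?_⟩
  by_contra h3
  apply h2
  exact ⟨U, hU, N, ψ, hadm, pileUpForcesLimitAtom ψ (fun L hL => (hadm L hL).2.1) h3⟩

end Summit.HubbardSuperconductivity.HubbardSuperconductivity.Theorems.NoInfraredPileUp.Negative
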